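import Mathlib
import Literature.Combinatorics.Enumerative.BregmanMinc
import Summits.ValiantsHypothesis.ValiantsHypothesis.Theorems.DivisionGapPerMultiplesHardStubBregmanFibre

/-!
# `DivisionGap.PerMultiplesHard` (stmt-ValiantsHypothesis-5068), line `uncharged-face-walk`:
stub `stub_blockBregman` — Brégman–Minc on a block padded by a frozen matching

Fix a row set `A`, a column set `B`, a graph `Yb ⊆ A ×ˢ B` on the block (cells `(row, column)`;
permutations map columns to rows), a reference permutation `π₀`, a column set `T ⊆ B` and a row
set `U ⊆ A`.  Let `X` be the set of permutations `π` that are FROZEN to `π₀` off the column block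
(`π j = π₀ j` for `j ∉ B`), lie inside `Yb` on the block (`(π j, j) ∈ Yb` for `j ∈ B`) and satisfy
`π(T) = U`.  Then

  `#X ≤ ∏_{j ∈ B} (d_j !)^(1/d_j)`,

where `d_j = #{i ∈ U : (i, j) ∈ Yb}` for `j ∈ T` and `d_j = #{i ∈ A \ U : (i, j) ∈ Yb}` for
`j ∈ B \ T` (`stub_blockBregman`).

Proof.  The tree's Brégman–Minc theorem in set form
(`Literature.Combinatorics.Enumerative.card_le_prod_factorial_rpow`, [Bregman1973, Thm 1]) gives
`#X ≤ ∏_j (r_j !)^(1/r_j)` over ALL columns `j`, with `r_j = #{π j : π ∈ X}` the row support of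
`X` at column `j`.  For `j ∈ B` the row support lies in the degree set `D_j` whose size is `d_j`
(`image_apply_subset_blockDegSet`: for `j ∈ T`, `π j ∈ π(T) = U`; for `j ∈ B \ T`,
`(π j, j) ∈ Yb ⊆ A ×ˢ B` gives `π j ∈ A`, and `π j ∉ U = π(T)` by injectivity of `π`), so the
factor at `j` is at most `(d_j !)^(1/d_j)` by monotonicity of `r ↦ (r !)^(1/r)`
(`BregmanFibre.factorial_rpow_mono`).  For `j ∉ B` the row support lies in `{π₀ j}`
(`image_apply_subset_singleton`), so `r_j ≤ 1` and the factor is `(1)^(1/r_j) = 1`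
(`factorial_rpow_eq_one_of_le_one`); hence the product over all columns collapses to the product
over `B` (`prod_univ_factorial_rpow_le_prod`).
-/

noncomputable section

-- `Summit.ValiantsHypothesis.ValiantsHypothesis.…` is the tree's mandated layout (Sub = Summit).
set_option linter.dupNamespace false

namespace Summit.ValiantsHypothesis.ValiantsHypothesis.Theorems.DivisionGap.PerMultiplesHard.BlockBregman

open Finset Literature.Combinatorics.Enumerative
open scoped BigOperators

/-- The Brégman factor `(r !)^(1/r)` equals `1` for `r ≤ 1` (`0 ! = 1 ! = 1` and `1 ^ x = 1`).
[folklore] -/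
theorem factorial_rpow_eq_one_of_le_one {r : ℕ} (hr : r ≤ 1) :
    ((r.factorial : ℕ) : ℝ) ^ ((1 : ℝ) / (r : ℝ)) = 1 := by
  rw [Nat.factorial_eq_one.mpr hr, Nat.cast_one, Real.one_rpow]

/-- **Collapsing a Brégman product to a block.**  If `r j ≤ d j` on `B` and `r j ≤ 1` off `B`,
then `∏_j (r_j !)^(1/r_j) ≤ ∏_{j ∈ B} (d_j !)^(1/d_j)`: the factors off `B` equal `1`
(`factorial_rpow_eq_one_of_le_one`) and `r ↦ (r !)^(1/r)` is monotone
(`BregmanFibre.factorial_rpow_mono`). [folklore] -/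
theorem prod_univ_factorial_rpow_le_prod {α : Type*} [Fintype α] (r d : α → ℕ) (B : Finset α)
    (hB : ∀ j ∈ B, r j ≤ d j) (hoff : ∀ j, j ∉ B → r j ≤ 1) :
    ∏ j, (((r j).factorial : ℕ) : ℝ) ^ ((1 : ℝ) / (r j : ℝ)) ≤
      ∏ j ∈ B, (((d j).factorial : ℕ) : ℝ) ^ ((1 : ℝ) / (d j : ℝ)) := by
  have h : ∏ j ∈ B, (((r j).factorial : ℕ) : ℝ) ^ ((1 : ℝ) / (r j : ℝ)) =
      ∏ j, (((r j).factorial : ℕ) : ℝ) ^ ((1 : ℝ) / (r j : ℝ)) :=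
    Finset.prod_subset (Finset.subset_univ B) fun j _ hj =>
      factorial_rpow_eq_one_of_le_one (hoff j hj)
  rw [← h]
  exact Finset.prod_le_prod (fun j _ => Real.rpow_nonneg (Nat.cast_nonneg _) _)
    fun j hj => BregmanFibre.factorial_rpow_mono (hB j hj)

/-- **Row supports on the block.**  Let `X` be a set of permutations each of which lies inside
`Yb ⊆ A ×ˢ B` on the column block `B` and maps `T` onto `U`.  For a column `j ∈ B` the row
support `{π j : π ∈ X}` lies in `{i ∈ U : (i, j) ∈ Yb}` if `j ∈ T` (`π j ∈ π(T) = U`) and in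
`{i ∈ A \ U : (i, j) ∈ Yb}` if `j ∉ T` (`π j ∈ A` as `(π j, j) ∈ Yb ⊆ A ×ˢ B`, and
`π j ∉ U = π(T)` by injectivity of `π`). [folklore] -/
theorem image_apply_subset_blockDegSet (n : ℕ) (A B : Finset (Fin n))
    (Yb : Finset (Fin n × Fin n)) (T U : Finset (Fin n)) (hYb : Yb ⊆ A ×ˢ B)
    (X : Finset (Equiv.Perm (Fin n)))
    (hX : ∀ π ∈ X, (∀ j ∈ B, (π j, j) ∈ Yb) ∧ T.image ⇑π = U) {j : Fin n} (hj : j ∈ B) :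
    X.image (fun σ => σ j) ⊆
      (if j ∈ T then U.filter fun i => (i, j) ∈ Yb else (A \ U).filter fun i => (i, j) ∈ Yb) := by
  intro i hi
  obtain ⟨π, hπ, rfl⟩ := Finset.mem_image.mp hi
  obtain ⟨hY, hTU⟩ := hX π hπ
  by_cases hjT : j ∈ T
  · rw [if_pos hjT, Finset.mem_filter]
    refine ⟨?_, hY j hj⟩
    rw [← hTU]
    exact Finset.mem_image_of_mem _ hjT
  · rw [if_neg hjT, Finset.mem_filter, Finset.mem_sdiff]
    refine ⟨⟨(Finset.mem_product.mp (hYb (hY j hj))).1, fun hU => hjT ?_⟩, hY j hj⟩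
    rw [← hTU] at hU
    obtain ⟨j', hj', hjj'⟩ := Finset.mem_image.mp hU
    rw [π.injective hjj'] at hj'
    exact hj'

/-- **Row supports off the block are frozen.**  If every permutation of `X` agrees with `π₀` off
the column block `B`, then for `j ∉ B` the row support `{π j : π ∈ X}` lies in `{π₀ j}`.
[folklore] -/
theorem image_apply_subset_singleton (n : ℕ) (B : Finset (Fin n)) (π₀ : Equiv.Perm (Fin n))
    (X : Finset (Equiv.Perm (Fin n))) (hX : ∀ π ∈ X, ∀ j, j ∉ B → π j = π₀ j) {j : Fin n}
    (hj : j ∉ B) :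
    X.image (fun σ => σ j) ⊆ {π₀ j} := by
  intro i hi
  obtain ⟨π, hπ, rfl⟩ := Finset.mem_image.mp hi
  exact Finset.mem_singleton.mpr (hX π hπ j hj)

/-- **stub_blockBregman — Brégman–Minc on a block padded by a frozen matching.**  For a row set
`A`, a column set `B`, a graph `Yb ⊆ A ×ˢ B` (cells `(row, column)`), a reference permutation
`π₀`, columns `T ⊆ B` and rows `U ⊆ A`, the permutations `π` frozen to `π₀` off `B`
(`π j = π₀ j` for `j ∉ B`), inside `Yb` on `B` (`(π j, j) ∈ Yb` for `j ∈ B`) and with `π(T) = U`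
number at most `∏_{j ∈ B} (d_j !)^{1/d_j}`, where `d_j = #{i ∈ U : (i, j) ∈ Yb}` for `j ∈ T`
and `d_j = #{i ∈ A \ U : (i, j) ∈ Yb}` for `j ∈ B \ T`.  The set form of Brégman–Minc
(`Literature.Combinatorics.Enumerative.card_le_prod_factorial_rpow`) bounds the count by
`∏_j (r_j !)^{1/r_j}` over all columns, `r_j` the row-support sizes; on `B` the row supports lie
in the degree sets (`image_apply_subset_blockDegSet`) and `r ↦ (r !)^{1/r}` is monotone, off `B`
they lie in `{π₀ j}` (`image_apply_subset_singleton`) so the factor is `1`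
(`prod_univ_factorial_rpow_le_prod`).  The hypotheses `T ⊆ B`, `U ⊆ A` are not needed.
[cite: Bregman1973, Thm 1] -/
theorem stub_blockBregman :
    ∀ (n : ℕ) (A B : Finset (Fin n)) (Yb : Finset (Fin n × Fin n)) (π₀ : Equiv.Perm (Fin n)) (T U : Finset (Fin n)),
      Yb ⊆ A ×ˢ B → T ⊆ B → U ⊆ A →
      ((((Finset.univ : Finset (Equiv.Perm (Fin n))).filter fun π : Equiv.Perm (Fin n) =>
            (∀ j, j ∉ B → π j = π₀ j) ∧ (∀ j ∈ B, (π j, j) ∈ Yb) ∧ T.image ⇑π = U).card : ℕ) : ℝ) ≤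
        ∏ j ∈ B,
          ((((if j ∈ T then U.filter fun i => (i, j) ∈ Yb else (A \ U).filter fun i => (i, j) ∈ Yb).card.factorial : ℕ) : ℝ) ^
            ((1 : ℝ) / ((if j ∈ T then U.filter fun i => (i, j) ∈ Yb else (A \ U).filter fun i => (i, j) ∈ Yb).card : ℝ))) := by
  intro n A B Yb π₀ T U hYb _ _
  refine (card_le_prod_factorial_rpow _).trans
    (prod_univ_factorial_rpow_le_prod _
      (fun j => (if j ∈ T then U.filter fun i => (i, j) ∈ Yb
        else (A \ U).filter fun i => (i, j) ∈ Yb).card) B (fun j hj => ?_) fun j hj => ?_)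
  · exact Finset.card_le_card (image_apply_subset_blockDegSet n A B Yb T U hYb _
      (fun π hπ => (Finset.mem_filter.mp hπ).2.2) hj)
  · exact (Finset.card_le_card (image_apply_subset_singleton n B π₀ _
      (fun π hπ => (Finset.mem_filter.mp hπ).2.1) hj)).trans (Finset.card_singleton _).le

end Summit.ValiantsHypothesis.ValiantsHypothesis.Theorems.DivisionGap.PerMultiplesHard.BlockBregman

end
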